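import Mathlib

/-!
# critic g28 — cards k2-g24 / k3-g24 (`stub_heegnerIndexLowerAtTwo`, stmt-BirchSwinnertonDyer-27851), kernel checks

Mathlib only; nothing here is a tree fact or a proposal.  Four shapes used in STUB-PLAN v4.8 rows 68 / 69:

(1) `exists_E2_of_ne_zero` — with the (2)₂-exponent `x₂` FREE (∃-quantified), k2-g24's product law
    `E₂·A = ε·B`, `‖E₂‖² = 2^{x₂}` is satisfiable by construction as soon as `A = val·Ωp·⟨y₀,y₀⟩ ≠ 0`,
    `B = 𝓛′·(log_ω y₀)² ≠ 0`, `ε ≠ 0`: so `RubinProductLawAtTwo … x₂` is stub-grade ONLY with `x₂` PINNED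
    by the (2)₂ node (k3-g24's `x₂ = 2 − 2k`), never with `x₂` free (B12 / K11).
(2) `law_covariant` — the product law is ω-COVARIANT of degree 1: replacing `ω` by `c·ω` sends
    `E₂ ↦ c·E₂` ((2)₂'s LHS is `log_ω`), `ε_loc ↦ c⁻¹·ε_loc` (`exp*_ω`), `log_ω y₀ ↦ c·log_ω y₀`, and the law
    is preserved: the differential-normalisation digit (k2-g24's `ϖ` / K3, k3-g24's `k`) is a CONVENTION that
    cancels in the JOINT (2)₂ ⊗ (3)₂ digit iff both nodes book the same `ω` — it is not a digit of the stub.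
(3) `condExp_agree_on_class` — the two cards' conductor exponents (`wildExp d = if d even then 3 else 2`,
    `twistCondExp d = if d ≡ 3 (4) then 2 else 3`) AGREE on the stub's class (`d` squarefree-at-2, `d ≢ 1 (4)`),
    so the two independently met cancellations `a(d) − v₂(d) = 2` are ONE identity.
(4) `joint_prediction` — with `x₂ = 2` ((2)₂, reading R+, `k = 0`) and `‖ε_loc‖² = ¼` ((3)₂, R+) the norm law
    `2^{x₂}·V = ¼·Y` reads `V = Y/16`: `‖val‖²‖Ωp‖²‖⟨y₀,y₀⟩‖² = ‖𝓛′‖²‖log_ω y₀‖⁴/16` on the class — the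
    falsifiable JOINT DIGIT of rows 68 / 69 (R172).
-/

namespace CriticK2G24

/-- (1) x₂ free ⟹ the product law holds by construction (choose `E₂ := ε·B/A`, `x₂ := log₂ ‖E₂‖²`). -/
theorem exists_E2_of_ne_zero {F : Type*} [NormedField F] {A B ε : F}
    (hA : A ≠ 0) (hB : B ≠ 0) (hε : ε ≠ 0) :
    ∃ (E₂ : F) (x₂ : ℝ), ‖E₂‖ ^ 2 = (2 : ℝ) ^ x₂ ∧ E₂ * A = ε * B := by
  have hne : ε * B / A ≠ 0 := div_ne_zero (mul_ne_zero hε hB) hA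
  have hpos : 0 < ‖ε * B / A‖ ^ 2 := pow_pos (norm_pos_iff.mpr hne) 2
  refine ⟨ε * B / A, Real.logb 2 (‖ε * B / A‖ ^ 2), ?_, div_mul_cancel₀ (ε * B) hA⟩
  rw [Real.rpow_logb (by norm_num) (by norm_num) hpos]

/-- (1′) … and conversely a PINNED `x₂` makes the law pin `‖A‖` against `‖B‖` (content = the norm law). -/
theorem norm_pinned_of_law {F : Type*} [NormedField F] {A B ε E₂ : F} {x₂ : ℝ}
    (hE : ‖E₂‖ ^ 2 = (2 : ℝ) ^ x₂) (hlaw : E₂ * A = ε * B) :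
    (2 : ℝ) ^ x₂ * ‖A‖ ^ 2 = ‖ε‖ ^ 2 * ‖B‖ ^ 2 := by
  have h := congrArg (fun z : F ↦ ‖z‖ ^ 2) hlaw
  simp only [norm_mul, mul_pow] at h
  rw [hE] at h
  exact h

/-- (2) ω-covariance of degree 1 of the product law `E₂·val·Ω·h = ε·L·logω²`. -/
theorem law_covariant {F : Type*} [Field F] {E₂ val Ω h ε L logω c : F} (hc : c ≠ 0)
    (hlaw : E₂ * val * Ω * h = ε * L * logω ^ 2) :
    (c * E₂) * val * Ω * h = (c⁻¹ * ε) * L * (c * logω) ^ 2 := by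
  have h1 : (c⁻¹ * ε) * L * (c * logω) ^ 2 = c * (ε * L * logω ^ 2) := by
    field_simp
  rw [h1, ← hlaw]
  ring

/-- (2′) hence the JOINT norm digit `2^{x₂}/‖ε‖²`-balance is ω-free: scaling multiplies both sides by `‖c‖²`. -/
theorem joint_digit_omega_free {E₂n εn logn c : ℝ} (hc : 0 < c) (V Y : ℝ)
    (hlaw : E₂n ^ 2 * V = εn ^ 2 * Y * logn ^ 4) :
    (c * E₂n) ^ 2 * V = (c⁻¹ * εn) ^ 2 * Y * (c * logn) ^ 4 := by
  have hc0 : c ≠ 0 := hc.ne'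
  have : (c⁻¹ * εn) ^ 2 * Y * (c * logn) ^ 4 = c ^ 2 * (εn ^ 2 * Y * logn ^ 4) := by
    field_simp
  rw [this, ← hlaw]
  ring

/-- k2-g24's conductor exponent of `ℚ₂(√d)/ℚ₂` (`wildExp`). -/
def wildExp (d : ℤ) : ℕ := if d % 2 = 0 then 3 else 2

/-- k3-g24's conductor exponent of `χ_{d,v}` (`twistCondExp`). -/
def twistCondExp (d : ℤ) : ℤ := if d % 4 = 3 then 2 else 3

/-- (3) the two exponents agree on the class `d ≢ 0, 1 (mod 4)` (squarefree at 2, additive twist). -/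
theorem condExp_agree_on_class (d : ℤ) (h0 : d % 4 ≠ 0) (h1 : d % 4 ≠ 1) :
    (wildExp d : ℤ) = twistCondExp d := by
  unfold wildExp twistCondExp
  have h4 : d % 4 = 2 ∨ d % 4 = 3 := by omega
  rcases h4 with h | h
  · have h2 : d % 2 = 0 := by omega
    simp [h2, h]
  · have h2 : d % 2 ≠ 0 := by omega
    simp [h2, h]

/-- k3-g24's `discVal` (= `v₂(d)` on the class) and the shared cancellation `e(d) − v₂(d) = 2`. -/
def discVal (d : ℤ) : ℤ := if d % 4 = 3 then 0 else 1

theorem cancellation_both_cards (d : ℤ) (h0 : d % 4 ≠ 0) (h1 : d % 4 ≠ 1) :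
    (wildExp d : ℤ) - discVal d = 2 := by
  rw [condExp_agree_on_class d h0 h1]
  unfold twistCondExp discVal
  split <;> simp

/-- (4) the joint prediction: `x₂ = 2` and `‖ε‖² = ¼` turn `2^{x₂}·V = ‖ε‖²·Y` into `V = Y/16`. -/
theorem joint_prediction {V Y : ℝ} (h : (2 : ℝ) ^ (2 : ℝ) * V = (4 : ℝ)⁻¹ * Y) : V = Y / 16 := by
  have h4 : (2 : ℝ) ^ (2 : ℝ) = 4 := by
    rw [show (2 : ℝ) = ((2 : ℕ) : ℝ) by norm_num, Real.rpow_natCast]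
    norm_num
  rw [h4] at h
  linarith

end CriticK2G24
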